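import Summits.ValiantsHypothesis.ValiantsHypothesis.Theses.CirculantFourier

/-!
# Route CirculantFourier — item `Assembly`

Item `stmt-ValiantsHypothesis-6313` (rank-1 assembly of route `CirculantFourier`):
`SensitiveMonotoneHard → HrubesBridge → RealForms → CircHub → ValiantsHypothesis`.

Pure bookkeeping. By `CircHub` it suffices to refute `IsPComputable q` for the circulant
permanent family `q_n = per (circulant x)`. If `L(q_n) ≤ n ^ a + a`, `RealForms` gives real forms
`r_n` of the Fourier form `QF_n` with `deg r_n ≤ n` and `L_ℝ(r_n) ≤ C_R (L(q_n) + n² + 1)`;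
`HrubesBridge` with `d = n` gives `ε₀(n) > 0` and, for `ε_n := min (ε₀/2) (1/2) ∈ (0, 1)`, a plain
monotone circuit of size `≤ C_H (L_ℝ(r_n) + 2n + 1)³` computing some `g_n` over `ℝ≥0` with
`map g_n = U_n + ε_n r_n` over `ℝ`, hence `map g_n = U_n + ε_n QF_n` over `ℂ` (`MvPolynomial.map_map`
and ring-hom compatibilities). The size bound is a p-bounded function of `n` (closure of
`IsPBounded` under `+`, `*`, `^`, all proved in
`Literature.Computability.AlgebraicComplexity.ValiantClasses`), say `≤ n ^ c + c`, contradicting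
`SensitiveMonotoneHard` at this `c`. No named-fact hypothesis: the theorem is unconditional (its four
hypotheses are the route's own items, taken as stated).
-/

namespace Summit.ValiantsHypothesis.Theorems

open Literature.Computability.AlgebraicComplexity

/-- **Assembly** (route CirculantFourier, item `stmt-ValiantsHypothesis-6313`):
`SensitiveMonotoneHard → HrubesBridge → RealForms → CircHub → ValiantsHypothesis`.
Bookkeeping: a p-bounded circuit complexity for the circulant permanent family would, through
`RealForms` (realification of the Fourier form) and `HrubesBridge` (Hrubeš 2020, Thm. 1, as the
route states it) produce, for every `n ≥ 1`, some `ε_n ∈ (0,1)` and a plain monotone circuit of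
p-bounded size for `(1 + Σ μ_m)^n + ε_n · QF_n`, which `SensitiveMonotoneHard` forbids; `CircHub`
turns `¬ IsPComputable q` into `ValiantsHypothesis`. [folklore] -/
theorem circulantFourier_assembly_proof :
    Summit.ValiantsHypothesis.ValiantsHypothesis.Theses.CirculantFourier.Assembly := by
  unfold Summit.ValiantsHypothesis.ValiantsHypothesis.Theses.CirculantFourier.Assembly
  intro hSMH hHB hRF hHub
  apply hHub
  intro hq
  apply hSMH
  obtain ⟨CH, hCH⟩ := hHB
  obtain ⟨CR, hCR⟩ := hRF
  -- the size bound as a p-bounded function of `n`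
  have hS : IsPBounded fun n => CH * (CR * (complexity ((Matrix.circulant fun i : Fin n =>
      (MvPolynomial.X i : MvPolynomial (Fin n) ℂ)).permanent) + n * n + 1) + n + n + 1) ^ 3 :=
    IsPBounded.mul_holds (IsPBounded.const CH) (IsPBounded.pow_holds (IsPBounded.add_holds
      (IsPBounded.add_holds (IsPBounded.add_holds (IsPBounded.mul_holds (IsPBounded.const CR)
      (IsPBounded.add_holds (IsPBounded.add_holds hq (IsPBounded.mul_holds IsPBounded.id
      IsPBounded.id)) (IsPBounded.const 1))) IsPBounded.id) IsPBounded.id) (IsPBounded.const 1)) 3)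
  obtain ⟨c, hc⟩ := hS
  refine ⟨c, fun n hn => ?_⟩
  obtain ⟨r, hr_map, hr_deg, hr_cplx⟩ := hCR n hn
  obtain ⟨ε₀, hε₀, hε⟩ := hCH n n r hr_deg
  have hεpos : 0 < min (ε₀ / 2) (1 / 2) := lt_min (half_pos hε₀) one_half_pos
  have hεlt : min (ε₀ / 2) (1 / 2) < ε₀ := (min_le_left _ _).trans_lt (half_lt_self hε₀)
  have hε1 : min (ε₀ / 2) (1 / 2) < 1 := (min_le_right _ _).trans_lt one_half_lt_one
  obtain ⟨g, P, hg_map, hmono, hsize⟩ := hε _ hεpos hεlt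
  refine ⟨min (ε₀ / 2) (1 / 2), hεpos, hε1, g, P, ?_, hmono, ?_⟩
  · rw [← MvPolynomial.map_map, hg_map]
    simp only [map_add, map_pow, map_one, map_sum, MvPolynomial.map_X, map_mul,
      MvPolynomial.map_C, Complex.ofRealHom_eq_coe, hr_map]
  · refine hsize.trans (le_trans ?_ (hc n))
    dsimp only
    gcongr

end Summit.ValiantsHypothesis.Theorems
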